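import Summits.NavierStokesRegularity.NavierStokesRegularity.Theorems.ScenarioCensusScrewBlowdownLPTools
import HarnessLib

/-!
# LINE «screw-blowdown» port, part 10/13: the `LocalPersistence` appendix (b) — `rho`, `duhamel_bound`

Re-homed for the scenario census (typer seat ns-census-typer-1 g7; lead g9 RULINGS [7] 20:33Z / [8] 21:03Z / [12](b) 21:58Z: «screw-blowdown v1.8 =
version of record; `Row_A13isqT` DECIDED IN KERNEL → CANDIDATE-DECIDED member under A13 (row already TREE); typer-1 slot 3 port of record =
`ScrewBlowdown_port_v1_8.lean` bb5f719a8be448dd (stub-free)»; lead g10 RULINGS [1](b) 22:36Z / [2] 22:42Z: «port v1.9 ffe1ad3d1d25e376 = port of record (idea-crit-3 DIFF-CHECK 22:40:40Z CONFORMS); slot 4 = its S3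
appendix ADMISSIBLE after slot 3»; ref PRE-CHECKs items 13 / 15 / 20 / 27): VERBATIM PORT of ns-idea-4 LINE g12-1 «screw-blowdown» PORT copy
`pub/ideators/ns-idea-4/lines/screw-blowdown/port/ScrewBlowdown_port_v1_9.lean` sha16 ffe1ad3d1d25e376 (2890 l.; lean check rc 0, 0 sorry; = the v1.8
port copy bb5f719a8be448dd as a literal prefix — itself the v1.7 copy 674e939b7b0b34e8 + the `LocalPersistence` attack appendix `…LP` + the consequences
`localPersistence_holds` / `farPastSpreading_holds` / `linearConeLiouville_holds` / `row_A13isqT_proved` — plus the v1.9 S3 block: `vanishingBlowdownLiouville_holds`,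
`row_ArecT_proved`; parts 1–3 landed while v1.8 was the copy of record, text identical),
split for the 400-line rule into `ScenarioCensusScrewBlowdown` (§1–§3: objects, the cell `Row_A13isqT`, obligation Props, S1 PROVED) →
`…Plumbing` (§4, S2 PROVED) → `…Bridges` (§5 + v1.3) → `…Recurrent` (v1.4, `Row_ArecT`) → `…OffAxis` (v1.5 a) → `…Cone` (v1.5 b:
`farPast_linearCone_smallness_of_screw`) → `…Residual` (v1.5 c + v1.6: `LinearConeLiouville`, DSS rungs) → `…Propagation` (v1.7: FS, LP,
reductions; the three class-general tools are NOT re-declared — taken BY NAME, general `E`, from `Theorems/TypeIAncientMildForwardUniqueness.lean`,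
ns-idea-4 extract a1b589f6dec7da83, p671177) → `…LPTools` / `…LPDuhamel` / `…LP` (the appendix: Gaussian locality, the three-term Oseen split,
time weights; `duhamel_bound`; the bootstrap `one_step` / `persist` / `localPersistence` + the consequences incl. `row_A13isqT_proved`) →
`…Vanishing` (v1.9: S3 proved, `row_ArecT_proved`) → `…Keys` (census keys `Row_A13isqT` / `Row_ArecT` + `_excluded`).  Lean text VERBATIM in namespaces `…Theorems.ScenarioCensus.ScrewBlowdown` / `…ScrewBlowdownLP` (the line's
`…Lines.ScrewBlowdownPort` / `…PortLP` re-homed; qualified references renamed accordingly); port edits: `local notation "E3"` → `abbrev E3` (the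
appendix `open`s it), `@[conjecture]` on `VanishingBlowdownLiouville` only (part 1 landed while S3 was open; an obligation node, now with the closed
witness `vanishingBlowdownLiouville_holds`), seven one-line docstrings added, `continuous_rotZ_angle'` not re-declared (it restates the tree's
`Literature.Analysis.FluidPDE.continuous_rotZ_angle`, gate lint `dedup.landed`; its uses renamed), the line's `set_option linter.unusedVariables false` dropped (five proof lambdas
bind the unused `θ₀ h` as `_ _`; the unused hypothesis binders of `hasVanishingBlowdown_of_axiallyRecurrent` / `pointwise_small_of_zoom_small` are spelled `_hu` / `_hΛ`,
statements otherwise identical); `set_option maxHeartbeats … in` of the appendix kept as in the line.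

No census VALUE is moved by this file (row A13 is TREE already; the lead books the member A13isq-T); NS regularity is NOT proved; (L′)
`SymmetryModuliCount.TypeIAncientLiouville` is untouched (hypothesis of bridges only); no summit statement is proved by this file.
-/

-- the summit and its single problem share the name `NavierStokesRegularity` (D-0017 nested layout)
set_option linter.dupNamespace false

open MeasureTheory Filter Topology Real Set Metric
open Literature.Analysis Literature.Analysis.FluidPDE Literature.Analysis.UnboundedOperators

namespace Summit.NavierStokesRegularity.NavierStokesRegularity.Theorems.ScenarioCensus.ScrewBlowdownLP

noncomputable section

open Summit.NavierStokesRegularity.NavierStokesRegularity.Theorems.ScenarioCensus.ScrewBlowdown (E3)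

/-- The shrinking control radius `ρ(τ) = R/2 + κ√(−τ)`. -/
def rho (R κ τ : ℝ) : ℝ := R / 2 + κ * Real.sqrt (-τ)

set_option maxHeartbeats 1600000 in
/-- **The Duhamel term under the induction hypothesis.**  `u ∈ A_C`, `C ≤ K`, `1 ≤ K`, `2A ≤ K`, `0 ≤ A`, `0 < q ≤ 1`,
`0 < κ`, `s₀ < σ < 0`; if `√(−τ)‖u(τ,z)‖ ≤ 2A` for `τ ∈ (s₀,σ)` and `dist z x ≤ ρ(τ)`, then at every `y` with
`dist y x ≤ ρ(σ)`:
`‖B¹_{s₀}(u,u)(σ)(y)‖ ≤ (20 C₀ A² + 16 C₁ K²/(κ q²) + 2 C₀ K² q)/√(−σ)`, `C₀ = oseenSliceConst`, `C₁` the far constant. -/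
theorem duhamel_bound {C₁ : ℝ} (hC₁ : 0 < C₁)
    (hmix : ∀ {σ : ℝ}, 0 < σ → ∀ {a b : E3 → E3},
      AEStronglyMeasurable a volume → AEStronglyMeasurable b volume →
      ∀ {Ma Mb ma mb : ℝ} {x : E3} {r : ℝ}, 0 < r → 0 ≤ ma → ma ≤ Ma → 0 ≤ mb →
      (∀ z, ‖a z‖ ≤ Ma) → (∀ z, ‖b z‖ ≤ Mb) →
      (∀ z, ‖x - z‖ < r → ‖a z‖ ≤ ma) → (∀ z, ‖x - z‖ < r → ‖b z‖ ≤ mb) →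
        ‖oseenSlice σ a b x‖ ≤ oseenSliceConst E3 * σ ^ (-(1 / 2 : ℝ)) * ma * mb + 2 * (C₁ * Ma * Mb / r))
    {C K A q κ R s₀ σ : ℝ} {u : ℝ → E3 → E3} (hu : IsTypeIAncientMild C u) (hCK : C ≤ K) (hK1 : 1 ≤ K)
    (hA0 : 0 ≤ A) (hAK : 2 * A ≤ K) (hq : 0 < q) (hq1 : q ≤ 1) (hκ : 0 < κ) (hs₀σ : s₀ < σ) (hσ : σ < 0)
    {x : E3} (hind : ∀ τ ∈ Ioo s₀ σ, ∀ z : E3, dist z x ≤ rho R κ τ → Real.sqrt (-τ) * ‖u τ z‖ ≤ 2 * A)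
    {y : E3} (hy : dist y x ≤ rho R κ σ) :
    ‖oseenDuhamel 1 s₀ u u σ y‖ ≤
      (20 * oseenSliceConst E3 * A ^ 2 + 16 * C₁ * K ^ 2 / (κ * q ^ 2) + 2 * oseenSliceConst E3 * K ^ 2 * q)
        / Real.sqrt (-σ) := by
  set C₀ := oseenSliceConst E3 with hC₀def
  have hC₀ : 0 < C₀ := oseenSliceConst_pos
  have hσ0 : 0 < -σ := by linarith
  have hsσ : 0 < Real.sqrt (-σ) := Real.sqrt_pos.2 hσ0
  have hK0 : 0 < K := by linarith
  set τ₁ : ℝ := (1 + q ^ 2) * σ with hτ₁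
  have hτ₁σ : τ₁ < σ := by rw [hτ₁]; nlinarith [sq_nonneg q, mul_pos (pow_pos hq 2) hσ0]
  -- the majorant
  set D : ℝ := Real.sqrt 2 * (4 * A ^ 2 * C₀) + 8 * C₁ * K ^ 2 / (κ * q ^ 2) with hD
  have hD0 : 0 ≤ D := by positivity
  set f₁ : ℝ → ℝ := fun τ => D * (-τ) ^ (-(3 / 2 : ℝ)) with hf₁
  set f₂ : ℝ → ℝ := fun τ => (4 * A ^ 2 * C₀ / (-σ)) * (Ioi (2 * σ)).indicator (fun τ => (σ - τ) ^ (-(1 / 2 : ℝ))) τ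
    with hf₂
  set f₃ : ℝ → ℝ := fun τ => (C₀ * K ^ 2 / (-σ)) * (Ioi τ₁).indicator (fun τ => (σ - τ) ^ (-(1 / 2 : ℝ))) τ with hf₃
  set h : ℝ → ℝ := fun τ => f₁ τ + f₂ τ + f₃ τ with hh
  -- integrability and integral of the majorant
  obtain ⟨hI1, hJ1⟩ := setIntegral_neg_rpow_three_halves hs₀σ.le hσ
  obtain ⟨hI2, hJ2⟩ := setIntegral_indicator_sub_rpow_le (a := s₀) (show 2 * σ < σ by linarith)
  obtain ⟨hI3, hJ3⟩ := setIntegral_indicator_sub_rpow_le (a := s₀) hτ₁σ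
  have hI1' : IntegrableOn f₁ (Ioo s₀ σ) := hI1.const_mul D
  have hI2' : IntegrableOn f₂ (Ioo s₀ σ) := hI2.const_mul _
  have hI3' : IntegrableOn f₃ (Ioo s₀ σ) := hI3.const_mul _
  have hint : IntegrableOn h (Ioo s₀ σ) := (hI1'.add hI2').add hI3' 
  -- pointwise domination of the slice
  have hdom : ∀ τ ∈ Ioo s₀ σ, ‖oseenSlice (σ - τ) (u τ) (u τ) y‖ ≤ h τ := by
    intro τ hτ
    have hτ0 : 0 < -τ := by linarith [hτ.2]
    have hτneg : τ < 0 := by linarith [hτ.2]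
    have hsτ : 0 < Real.sqrt (-τ) := Real.sqrt_pos.2 hτ0
    have hστ : 0 < σ - τ := by linarith [hτ.2]
    have hmeas : AEStronglyMeasurable (u τ) volume := hu.aestronglyMeasurable_slice hτneg
    -- global bound `K/√(−τ)`
    have hglob : ∀ z, ‖u τ z‖ ≤ K / Real.sqrt (-τ) := fun z =>
      (hu.norm_le hτneg z).trans (div_le_div_of_nonneg_right hCK hsτ.le)
    -- the three nonnegative pieces of `h τ`
    have hp1 : 0 ≤ f₁ τ := mul_nonneg hD0 (Real.rpow_nonneg hτ0.le _)
    have hind_nn : ∀ (c : ℝ), 0 ≤ (Ioi c).indicator (fun τ => (σ - τ) ^ (-(1 / 2 : ℝ))) τ := by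
      intro c
      by_cases hc : τ ∈ Ioi c
      · rw [Set.indicator_of_mem hc]; exact Real.rpow_nonneg hστ.le _
      · rw [Set.indicator_of_notMem hc]
    have hp2 : 0 ≤ f₂ τ := mul_nonneg (by positivity) (hind_nn _)
    have hp3 : 0 ≤ f₃ τ := mul_nonneg (by positivity) (hind_nn _)
    -- the near slice bound with the GLOBAL constants (valid always)
    have hbrute : ‖oseenSlice (σ - τ) (u τ) (u τ) y‖ ≤
        C₀ * (σ - τ) ^ (-(1 / 2 : ℝ)) * (K / Real.sqrt (-τ)) * (K / Real.sqrt (-τ)) :=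
      norm_oseenSlice_le_oseenSliceConst hστ hglob hglob y
    have hKK : (K / Real.sqrt (-τ)) * (K / Real.sqrt (-τ)) = K ^ 2 / (-τ) := by
      rw [div_mul_div_comm, Real.mul_self_sqrt hτ0.le, sq]
    rcases lt_or_ge τ₁ τ with hrec | hold
    · -- RECENT window `τ₁ < τ < σ`: `(−τ)^{−1} ≤ (−σ)^{−1}`... here `−τ ≥ −σ`, so `K²/(−τ) ≤ K²/(−σ)`
      have hi3 : (Ioi τ₁).indicator (fun τ => (σ - τ) ^ (-(1 / 2 : ℝ))) τ = (σ - τ) ^ (-(1 / 2 : ℝ)) :=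
        Set.indicator_of_mem (mem_Ioi.2 hrec) _
      have hle : C₀ * (σ - τ) ^ (-(1 / 2 : ℝ)) * (K ^ 2 / (-τ)) ≤ (C₀ * K ^ 2 / (-σ)) * (σ - τ) ^ (-(1 / 2 : ℝ)) := by
        have h1 : K ^ 2 / (-τ) ≤ K ^ 2 / (-σ) :=
          div_le_div_of_nonneg_left (sq_nonneg K) hσ0 (by linarith [hτ.2])
        have h2 : 0 ≤ C₀ * (σ - τ) ^ (-(1 / 2 : ℝ)) := mul_nonneg hC₀.le (Real.rpow_nonneg hστ.le _)
        calc C₀ * (σ - τ) ^ (-(1 / 2 : ℝ)) * (K ^ 2 / (-τ)) ≤ C₀ * (σ - τ) ^ (-(1 / 2 : ℝ)) * (K ^ 2 / (-σ)) :=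
              mul_le_mul_of_nonneg_left h1 h2
          _ = (C₀ * K ^ 2 / (-σ)) * (σ - τ) ^ (-(1 / 2 : ℝ)) := by ring
      calc ‖oseenSlice (σ - τ) (u τ) (u τ) y‖
          ≤ C₀ * (σ - τ) ^ (-(1 / 2 : ℝ)) * (K ^ 2 / (-τ)) := by rw [← hKK]; simpa [mul_assoc] using hbrute
        _ ≤ (C₀ * K ^ 2 / (-σ)) * (σ - τ) ^ (-(1 / 2 : ℝ)) := hle
        _ = f₃ τ := by rw [hf₃]; simp only; rw [hi3]
        _ ≤ h τ := by rw [hh]; simp only; linarith [hp1, hp2]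
    · -- OLD window `τ ≤ τ₁`: the three-term split at `y` with gap `r = κ(√(−τ) − √(−σ))`
      have hτold : (1 + q ^ 2) * (-σ) ≤ -τ := by rw [hτ₁] at hold; linarith
      have hgap := sqrt_gap hq hq1 hσ hτold
      set r : ℝ := κ * (Real.sqrt (-τ) - Real.sqrt (-σ)) with hr
      have hr0 : 0 < r := by
        rw [hr]; refine mul_pos hκ ?_
        exact lt_of_lt_of_le (by positivity) hgap
      -- local bounds on `B(y, r)`: `dist z x ≤ dist z y + dist y x < r + ρ(σ) = ρ(τ)`
      have hloc : ∀ z : E3, ‖y - z‖ < r → ‖u τ z‖ ≤ 2 * A / Real.sqrt (-τ) := by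
        intro z hz
        have hzx : dist z x ≤ rho R κ τ := by
          have h1 : dist z x ≤ dist z y + dist y x := dist_triangle z y x
          have h2 : dist z y < r := by rwa [dist_eq_norm, ← norm_neg, neg_sub]
          have h3 : r + rho R κ σ = rho R κ τ := by simp only [rho, hr]; ring
          linarith
        have := hind τ hτ z hzx
        rw [le_div_iff₀ hsτ]; linarith
      have hmaM : 2 * A / Real.sqrt (-τ) ≤ K / Real.sqrt (-τ) := div_le_div_of_nonneg_right hAK hsτ.le
      have hma0 : 0 ≤ 2 * A / Real.sqrt (-τ) := by positivity
      have hM := hmix hστ hmeas hmeas hr0 hma0 hmaM hma0 hglob hglob hloc hloc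
      -- simplify the two products
      have hmm : (2 * A / Real.sqrt (-τ)) * (2 * A / Real.sqrt (-τ)) = 4 * A ^ 2 / (-τ) := by
        rw [div_mul_div_comm, Real.mul_self_sqrt hτ0.le]; ring
      have hnear : C₀ * (σ - τ) ^ (-(1 / 2 : ℝ)) * (2 * A / Real.sqrt (-τ)) * (2 * A / Real.sqrt (-τ)) =
          4 * A ^ 2 * C₀ * ((σ - τ) ^ (-(1 / 2 : ℝ)) / (-τ)) := by
        rw [mul_assoc (C₀ * (σ - τ) ^ (-(1 / 2 : ℝ))), hmm]; ring
      have hfar : 2 * (C₁ * (K / Real.sqrt (-τ)) * (K / Real.sqrt (-τ)) / r) = 2 * C₁ * K ^ 2 / ((-τ) * r) := by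
        rw [mul_assoc C₁, hKK]; field_simp
      -- (i) far term ≤ (8 C₁ K²/(κ q²)) (−τ)^{−3/2}
      have hfar_le : 2 * C₁ * K ^ 2 / ((-τ) * r) ≤ (8 * C₁ * K ^ 2 / (κ * q ^ 2)) * (-τ) ^ (-(3 / 2 : ℝ)) := by
        have hr_ge : κ * (q ^ 2 * Real.sqrt (-τ) / 4) ≤ r := by rw [hr]; exact mul_le_mul_of_nonneg_left hgap hκ.le
        have h32 : (-τ) ^ (-(3 / 2 : ℝ)) = 1 / ((-τ) * Real.sqrt (-τ)) := by
          rw [Real.rpow_neg hτ0.le, show (3 / 2 : ℝ) = 1 + 1 / 2 by norm_num,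
            Real.rpow_add hτ0, Real.rpow_one, Real.sqrt_eq_rpow, inv_eq_one_div]
        rw [h32]
        have hden : 0 < (-τ) * (κ * (q ^ 2 * Real.sqrt (-τ) / 4)) := by positivity
        calc 2 * C₁ * K ^ 2 / ((-τ) * r) ≤ 2 * C₁ * K ^ 2 / ((-τ) * (κ * (q ^ 2 * Real.sqrt (-τ) / 4))) := by
              refine div_le_div_of_nonneg_left (by positivity) hden ?_
              exact mul_le_mul_of_nonneg_left hr_ge hτ0.le
          _ = (8 * C₁ * K ^ 2 / (κ * q ^ 2)) * (1 / ((-τ) * Real.sqrt (-τ))) := by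
              field_simp
              ring
      -- (ii) near term: `(σ−τ)^{−1/2}/(−τ) ≤ √2 (−τ)^{−3/2}` if `τ ≤ 2σ`, else `≤ (σ−τ)^{−1/2}/(−σ)`
      have hnear_le : 4 * A ^ 2 * C₀ * ((σ - τ) ^ (-(1 / 2 : ℝ)) / (-τ)) ≤
          Real.sqrt 2 * (4 * A ^ 2 * C₀) * (-τ) ^ (-(3 / 2 : ℝ)) + f₂ τ := by
        rw [hf₂]; simp only
        have hc : 0 ≤ 4 * A ^ 2 * C₀ := by positivity
        rcases le_or_gt τ (2 * σ) with h2 | h2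
        · -- `σ − τ ≥ (−τ)/2`
          have hge : (-τ) / 2 ≤ σ - τ := by linarith
          have hA' : (σ - τ) ^ (-(1 / 2 : ℝ)) ≤ ((-τ) / 2) ^ (-(1 / 2 : ℝ)) :=
            Real.rpow_le_rpow_of_nonpos (by positivity) hge (by norm_num)
          have e1 : ((-τ) / 2) ^ (-(1 / 2 : ℝ)) = Real.sqrt 2 * (-τ) ^ (-(1 / 2 : ℝ)) := by
            rw [Real.div_rpow hτ0.le (by norm_num), Real.rpow_neg (by norm_num : (0:ℝ) ≤ 2) (1 / 2),
              ← Real.sqrt_eq_rpow (2 : ℝ), div_inv_eq_mul, mul_comm]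
          have e2 : (-τ) ^ (-(3 / 2 : ℝ)) = (-τ) ^ (-(1 / 2 : ℝ)) / (-τ) := by
            rw [show (-(3 / 2 : ℝ)) = -(1 / 2 : ℝ) + (-1) by norm_num, Real.rpow_add hτ0, Real.rpow_neg_one]
            ring
          have hB' : ((-τ) / 2) ^ (-(1 / 2 : ℝ)) / (-τ) = Real.sqrt 2 * (-τ) ^ (-(3 / 2 : ℝ)) := by
            rw [e1, e2]; ring
          have h1 : (σ - τ) ^ (-(1 / 2 : ℝ)) / (-τ) ≤ Real.sqrt 2 * (-τ) ^ (-(3 / 2 : ℝ)) := by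
            rw [← hB']; exact div_le_div_of_nonneg_right hA' hτ0.le
          have := mul_le_mul_of_nonneg_left h1 hc
          have hi := mul_nonneg (show 0 ≤ 4 * A ^ 2 * C₀ / (-σ) by positivity) (hind_nn (2 * σ))
          linarith
        · have hi2 : (Ioi (2 * σ)).indicator (fun τ => (σ - τ) ^ (-(1 / 2 : ℝ))) τ = (σ - τ) ^ (-(1 / 2 : ℝ)) :=
            Set.indicator_of_mem (mem_Ioi.2 h2) _
          rw [hi2]
          have h1 : (σ - τ) ^ (-(1 / 2 : ℝ)) / (-τ) ≤ (σ - τ) ^ (-(1 / 2 : ℝ)) / (-σ) :=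
            div_le_div_of_nonneg_left (Real.rpow_nonneg hστ.le _) hσ0 (by linarith [hτ.2])
          have := mul_le_mul_of_nonneg_left h1 hc
          have hi := mul_nonneg (show 0 ≤ Real.sqrt 2 * (4 * A ^ 2 * C₀) by positivity) (Real.rpow_nonneg hτ0.le (-(3 / 2 : ℝ)))
          have e : 4 * A ^ 2 * C₀ * ((σ - τ) ^ (-(1 / 2 : ℝ)) / (-σ)) = (4 * A ^ 2 * C₀ / (-σ)) * (σ - τ) ^ (-(1 / 2 : ℝ)) := by
            ring
          linarith
      calc ‖oseenSlice (σ - τ) (u τ) (u τ) y‖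
          ≤ 4 * A ^ 2 * C₀ * ((σ - τ) ^ (-(1 / 2 : ℝ)) / (-τ)) + 2 * C₁ * K ^ 2 / ((-τ) * r) := by
            rw [← hnear, ← hfar]; exact hM
        _ ≤ h τ := by
            rw [hh]; simp only
            have e : f₁ τ = Real.sqrt 2 * (4 * A ^ 2 * C₀) * (-τ) ^ (-(3 / 2 : ℝ)) +
                (8 * C₁ * K ^ 2 / (κ * q ^ 2)) * (-τ) ^ (-(3 / 2 : ℝ)) := by rw [hf₁]; simp only; rw [hD]; ring
            linarith [hp3]
  -- integrate
  rw [oseenDuhamel_one_eq_setIntegral_oseenSlice]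
  refine (norm_integral_le_of_norm_le hint ?_).trans ?_
  · filter_upwards [ae_restrict_mem measurableSet_Ioo] with τ hτ using hdom τ hτ
  -- `∫ h ≤ D · 2/√(−σ) + (4A²C₀/(−σ)) · 2√(−σ) + (C₀K²/(−σ)) · 2 q √(−σ)`
  have hsplit : ∫ τ in Ioo s₀ σ, h τ = D * (∫ τ in Ioo s₀ σ, (-τ) ^ (-(3 / 2 : ℝ))) +
      (4 * A ^ 2 * C₀ / (-σ)) * (∫ τ in Ioo s₀ σ, (Ioi (2 * σ)).indicator (fun τ => (σ - τ) ^ (-(1 / 2 : ℝ))) τ) +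
      (C₀ * K ^ 2 / (-σ)) * (∫ τ in Ioo s₀ σ, (Ioi τ₁).indicator (fun τ => (σ - τ) ^ (-(1 / 2 : ℝ))) τ) := by
    have e1 : ∫ τ in Ioo s₀ σ, h τ = (∫ τ in Ioo s₀ σ, (f₁ τ + f₂ τ)) + ∫ τ in Ioo s₀ σ, f₃ τ :=
      integral_add (hI1'.add hI2') hI3'
    have e2 : ∫ τ in Ioo s₀ σ, (f₁ τ + f₂ τ) = (∫ τ in Ioo s₀ σ, f₁ τ) + ∫ τ in Ioo s₀ σ, f₂ τ :=
      integral_add hI1' hI2'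
    have e3 : ∫ τ in Ioo s₀ σ, f₁ τ = D * ∫ τ in Ioo s₀ σ, (-τ) ^ (-(3 / 2 : ℝ)) := integral_const_mul D _
    have e4 : ∫ τ in Ioo s₀ σ, f₂ τ =
        (4 * A ^ 2 * C₀ / (-σ)) * ∫ τ in Ioo s₀ σ, (Ioi (2 * σ)).indicator (fun τ => (σ - τ) ^ (-(1 / 2 : ℝ))) τ :=
      integral_const_mul _ _
    have e5 : ∫ τ in Ioo s₀ σ, f₃ τ =
        (C₀ * K ^ 2 / (-σ)) * ∫ τ in Ioo s₀ σ, (Ioi τ₁).indicator (fun τ => (σ - τ) ^ (-(1 / 2 : ℝ))) τ :=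
      integral_const_mul _ _
    rw [e1, e2, e3, e4, e5]
  rw [hsplit]
  have hsq2 : Real.sqrt (σ - 2 * σ) = Real.sqrt (-σ) := by congr 1; ring
  have hsq3 : Real.sqrt (σ - τ₁) = q * Real.sqrt (-σ) := by
    rw [hτ₁, show σ - (1 + q ^ 2) * σ = q ^ 2 * (-σ) by ring, Real.sqrt_mul' _ hσ0.le, Real.sqrt_sq hq.le]
  rw [hsq2] at hJ2
  rw [hsq3] at hJ3
  have hT1 : D * (∫ τ in Ioo s₀ σ, (-τ) ^ (-(3 / 2 : ℝ))) ≤ D * (2 / Real.sqrt (-σ)) := mul_le_mul_of_nonneg_left hJ1 hD0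
  have hT2 : (4 * A ^ 2 * C₀ / (-σ)) * (∫ τ in Ioo s₀ σ, (Ioi (2 * σ)).indicator (fun τ => (σ - τ) ^ (-(1 / 2 : ℝ))) τ)
      ≤ (4 * A ^ 2 * C₀ / (-σ)) * (2 * Real.sqrt (-σ)) := mul_le_mul_of_nonneg_left hJ2 (by positivity)
  have hT3 : (C₀ * K ^ 2 / (-σ)) * (∫ τ in Ioo s₀ σ, (Ioi τ₁).indicator (fun τ => (σ - τ) ^ (-(1 / 2 : ℝ))) τ)
      ≤ (C₀ * K ^ 2 / (-σ)) * (2 * (q * Real.sqrt (-σ))) := mul_le_mul_of_nonneg_left hJ3 (by positivity)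
  have hkey : ∀ c : ℝ, c / (-σ) * Real.sqrt (-σ) = c / Real.sqrt (-σ) := by
    intro c
    have hss : Real.sqrt (-σ) * Real.sqrt (-σ) = -σ := Real.mul_self_sqrt hσ0.le
    rw [eq_div_iff hsσ.ne', mul_assoc, hss]
    exact div_mul_cancel₀ c (neg_ne_zero.2 hσ.ne)
  have hsum : D * (2 / Real.sqrt (-σ)) + (4 * A ^ 2 * C₀ / (-σ)) * (2 * Real.sqrt (-σ)) +
      (C₀ * K ^ 2 / (-σ)) * (2 * (q * Real.sqrt (-σ))) =
      (2 * Real.sqrt 2 * (4 * A ^ 2 * C₀) + 16 * C₁ * K ^ 2 / (κ * q ^ 2) + 8 * A ^ 2 * C₀ + 2 * C₀ * K ^ 2 * q)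
        / Real.sqrt (-σ) := by
    have e : D * (2 / Real.sqrt (-σ)) + (4 * A ^ 2 * C₀ / (-σ)) * (2 * Real.sqrt (-σ)) +
        (C₀ * K ^ 2 / (-σ)) * (2 * (q * Real.sqrt (-σ))) =
        D * (2 / Real.sqrt (-σ)) + (4 * A ^ 2 * C₀ / (-σ) * Real.sqrt (-σ)) * 2 +
          (C₀ * K ^ 2 / (-σ) * Real.sqrt (-σ)) * (2 * q) := by ring
    rw [e, hkey, hkey, hD]
    field_simp
    ring
  have hfinal : (2 * Real.sqrt 2 * (4 * A ^ 2 * C₀) + 16 * C₁ * K ^ 2 / (κ * q ^ 2) + 8 * A ^ 2 * C₀ + 2 * C₀ * K ^ 2 * q)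
        / Real.sqrt (-σ) ≤ (20 * C₀ * A ^ 2 + 16 * C₁ * K ^ 2 / (κ * q ^ 2) + 2 * C₀ * K ^ 2 * q) / Real.sqrt (-σ) := by
    refine div_le_div_of_nonneg_right ?_ hsσ.le
    have hs2 : Real.sqrt 2 ≤ 3 / 2 := by
      rw [show (3 / 2 : ℝ) = Real.sqrt ((3 / 2) ^ 2) by rw [Real.sqrt_sq (by norm_num)]]
      exact Real.sqrt_le_sqrt (by norm_num)
    have hAC : 0 ≤ A ^ 2 * C₀ := mul_nonneg (sq_nonneg A) hC₀.le
    have h12 : 2 * Real.sqrt 2 * (4 * A ^ 2 * C₀) ≤ 12 * (A ^ 2 * C₀) := by nlinarith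
    nlinarith
  linarith

end

end Summit.NavierStokesRegularity.NavierStokesRegularity.Theorems.ScenarioCensus.ScrewBlowdownLP
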